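/-
Copyright: public-domain mathematics; typed transcription for the H21 Literature library (cell lit-balaban,
Phase-2 proof seat p16 gen 6 = literature-prover-lit-balaban-p16-g6-0).

statement-level skeleton of published theorems with citation tags; proofs where landed; nothing here is a claim about the Yang–Mills mass gap

# Bałaban, *Propagators and renormalization transformations for lattice gauge theories. I*,
# Commun. Math. Phys. **95** (1984) 17–40 — p. 38 «P = G′Q′*(Q′G′²Q′*)⁻¹Q′G′» IS `I − R` ((1.69)) on the product torus:
# b05's real matrix `KRe·kerRe·QGRe` of `P`, transported to r02's typed torus `T_η = Tor (fine n M)`, EQUALS `1 − RT = PcT + Pker`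
# (the P-bridge, step (b))

[cite: Balaban1984PropagatorsI]  T. Bałaban, Commun. Math. Phys. 95 (1984) 17–40.  p. 25 «The projection operator R … is an
orthogonal projection on the linear subspace ΔN(Q′_k)»; (1.69)–(1.70) pp. 29–30 «R = I − P», «P = Δ⁻¹Q′*(Q′Δ⁻²Q′*)⁻¹Q′Δ⁻¹»;
p. 38 ll. 7–10 «the representation P = G′Q′*(Q′G′²Q′*)⁻¹Q′G′».

WHAT THIS MODULE ADDS (SKELETON row B5.Prop1.2, census (vii) / r02 DESIGN-MEMO step (b); consumers: `B5PBridgeKernel126` (this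
seat: (1.126) for r02's `GradOp·PcT·GradOpᴴ` = p37's hypothesis h126), r02's (1.132) assembly):
* `torIdx P : Tor P ≃ Idx P` — r02's `chartSite` as an equivalence onto b04/b05's index type (`toZ ∘ torIdx = repZ`);
* `liftC` — transport of b05's REAL matrices on `Idx` to COMPLEX matrices on the typed tori, multiplicative;
* `Kfl n M a` := `KRe` transported, with **`Kfl_mulVec`**: `Kfl *ᵥ ω = KTvec ω` (= `G′Q′*ω`, `B5PBridgeGreenInverse`), hence
  `greenOp_mul_Kfl : (Δ + aQ′*Q′)·Kfl = Q′*`;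
* `Pfl n M a` := `KRe·kerRe·QGRe` transported (b05's «matrix of P»): Hermitian, `Pfl·Kfl = Kfl`, `Q′G′·Pfl = Q′G′`,
  `Pfl·(Δl) = 0` for `Q′l = 0`;
* §3 (v1.2): the printed representations LITERALLY in r02's typed vocabulary — `liftC_QGRe` (`= Q′G′`), `liftC_qggqRe` (`= Q′G′²Q′*`),
  `liftC_kerRe` (`= (Q′G′²Q′*)⁻¹`, with `QGGQs_inv_mul`/`QGGQs_mul_inv`), **`Pfl_eq_green`** (`Pfl = G′Q′*(Q′G′²Q′*)⁻¹Q′G′`, p. 38),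
  **`RT_eq_one_sub_green`** ((1.44)/(1.69): `RT = 1 − G′Q′*(Q′G′²Q′*)⁻¹Q′G′`), `PcT_add_Pker_eq_green` ((1.70) = p. 38 + constant mode);
* **`one_sub_Pfl_eq_RT`**: `1 − Pfl = RT n M` — the fixed space of the Hermitian `1 − Pfl` is `ΔN(Q′)` (p. 25), and `RT` is the
  only such matrix (`B5Identities197Torus`); **`Pfl_eq_PcT_add_Pker`**, and behind a gradient
  **`GradOp_PcT_GradOp_adjoint_eq`**: `∂·PcT·∂ᴴ = ∂·Pfl·∂ᴴ` — r02's `∂P∂*` block of `DeltaA` IS b05's matrix, transported.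

HONEST SCOPE.  Finite-dimensional linear algebra over LANDED kernel facts (b05 `B5QGGQ145Factor/Bounds`, r02 `B5Identities197Torus`,
`B5GreenBridgeP12Green`); the analysis ((1.126) itself) is b05's `B5DPD126Uniform`.  `a > 0` is any fixed constant (p. 25 «we will take eventually a = 1»); `Pfl` does not depend on it (it equals `PcT + Pker`).  Not summit progress.
-/
import Mathlib
import Literature.MathematicalPhysics.QuantumFieldTheory.Balaban1983to89.B5PBridgeGreenInverse
import Literature.MathematicalPhysics.QuantumFieldTheory.Balaban1983to89.B5DPD126Uniform
import Literature.MathematicalPhysics.QuantumFieldTheory.Balaban1983to89.B5Identities197Torus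
import Literature.MathematicalPhysics.QuantumFieldTheory.Balaban1983to89.B5RowSumsP12Lattice

open scoped BigOperators Matrix ComplexConjugate
open Finset Matrix

namespace Literature.MathematicalPhysics.QuantumFieldTheory.Balaban1983to89.B5PBridgeProjection

open Literature.MathematicalPhysics.QuantumFieldTheory.Balaban1983to89
open Literature.MathematicalPhysics.QuantumFieldTheory.Balaban1983to89.B5Prop11Plancherel (Tor fine)
open Literature.MathematicalPhysics.QuantumFieldTheory.Balaban1983to89.B5Action121 (LapS GradOp)
open Literature.MathematicalPhysics.QuantumFieldTheory.Balaban1983to89.B5Block118 (QsOp)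
open Literature.MathematicalPhysics.QuantumFieldTheory.Balaban1983to89.B5Hk160Torus (QsAdj)
open Literature.MathematicalPhysics.QuantumFieldTheory.Balaban1983to89.B5LaplaceInverse (Pker)
open Literature.MathematicalPhysics.QuantumFieldTheory.Balaban1983to89.B5Value126 (PcT)
open Literature.MathematicalPhysics.QuantumFieldTheory.Balaban1983to89.B5Identities197Torus (RT RT_conjTranspose
  RT_mulVec_LapS_of_ker RT_mulVec_eq_LapS GradOp_mul_RT)
open Literature.MathematicalPhysics.QuantumFieldTheory.Balaban1983to89.B4TorusPositivity (box)
open Literature.MathematicalPhysics.QuantumFieldTheory.Balaban1983to89.B4TorusGreen244 (KT)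
open Literature.MathematicalPhysics.QuantumFieldTheory.Balaban1983to89.B5QGGQ145Bounds (Idx toZ kerRe qggqRe kerRe_mul_qggqRe
  qggqRe_mul_kerRe kerRe_isSymm sum_box_eq_sum_idx)
open Literature.MathematicalPhysics.QuantumFieldTheory.Balaban1983to89.B5QGGQ145Factor (KRe KRe_coe QGRe QGRe_mul_KRe)
open Literature.MathematicalPhysics.QuantumFieldTheory.Balaban1983to89.B5RowSumsP12Lattice (chartSite)
open Literature.MathematicalPhysics.QuantumFieldTheory.Balaban1983to89.B5GreenBridgeP12Green (repZ castU KTvec green_KTvec)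
open Literature.MathematicalPhysics.QuantumFieldTheory.Balaban1983to89.B5PBridgeGreenInverse (isUnit_greenOp greenOp_mul_inv
  inv_mul_greenOp greenOp_isHermitian greenInv_isHermitian QsAdj_conjTranspose KTvec_eq_greenInv_mulVec)
open Literature.MathematicalPhysics.QuantumFieldTheory.Balaban1983to89.Beta.VectorPropagatorDict (ext_of_mulVec')
open Literature.MathematicalPhysics.QuantumFieldTheory.Balaban1983to89.Beta.FluctuationProjection (Pker_mul_GradOp_adjoint)

noncomputable section

/-! ## §1 The chart `Tor P ≃ Idx P` and the transport of real matrices -/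

section Chart

variable {d : ℕ} (P : Fin (d + 1) → ℕ) [hP : ∀ i, NeZero (P i)]

/-- r02's coordinates `chartSite` as an EQUIVALENCE `Π_i ℤ/P_i ≃ Π_i Fin P_i` onto b04/b05's index type `Idx P`.
[cite: Balaban1984PropagatorsI, p.18 (the lattice T_η), p.35 (T₁^{(k)})] -/
def torIdx : Tor P ≃ Idx P where
  toFun := chartSite P
  invFun k := fun i => ((k i : ℕ) : ZMod (P i))
  left_inv x := by
    funext i
    simp [chartSite]
  right_inv k := by
    funext i
    apply Fin.ext
    simp [chartSite, ZMod.val_natCast, Nat.mod_eq_of_lt (k i).isLt]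

/-- `torIdx = chartSite`. [cite: Balaban1984PropagatorsI, p.35 (T₁^{(k)})] -/
theorem torIdx_apply (x : Tor P) : torIdx P x = chartSite P x := rfl

/-- the inverse chart: residues of the coordinates. [cite: Balaban1984PropagatorsI, p.35 (T₁^{(k)})] -/
theorem torIdx_symm_apply (k : Idx P) (i : Fin (d + 1)) : (torIdx P).symm k i = ((k i : ℕ) : ZMod (P i)) := rfl

/-- `toZ ∘ torIdx` = the integer representatives. [cite: Balaban1984PropagatorsI, p.18] -/
theorem toZ_torIdx (x : Tor P) : toZ (torIdx P x) = fun i => ((x i).val : ℤ) := rfl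

/-- reading a representative back on the torus inverts the chart: `castU (toZ k) = torIdx⁻¹ k`. [cite: Balaban1984PropagatorsI, p.18] -/
theorem castU_toZ (k : Idx P) : castU P (toZ k) = (torIdx P).symm k := by
  funext i
  simp only [castU, torIdx_symm_apply, B5QGGQ145Bounds.toZ, Int.cast_natCast]

end Chart

section Lift

variable {m m' k k' l l' : Type*}

/-- transport of a real matrix along index equivalences, read over `ℂ`: `(liftC A e f) i j = A (e i) (f j)`. [cite: Balaban1984PropagatorsI, (1.120) p.37 (operators on T_η as matrices; index transport, dictionary)] -/
def liftC (A : Matrix m k ℝ) (em : m' ≃ m) (ek : k' ≃ k) : Matrix m' k' ℂ :=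
  fun i j => ((A (em i) (ek j) : ℝ) : ℂ)

/-- entries. [cite: Balaban1984PropagatorsI, (1.120) p.37 (operators on T_η as matrices; index transport, dictionary)] -/
@[simp] theorem liftC_apply (A : Matrix m k ℝ) (em : m' ≃ m) (ek : k' ≃ k) (i : m') (j : k') :
    liftC A em ek i j = ((A (em i) (ek j) : ℝ) : ℂ) := rfl

/-- the transport is multiplicative. [cite: Balaban1984PropagatorsI, (1.120) p.37 (operators on T_η as matrices; index transport, dictionary)] -/
theorem liftC_mul [Fintype k] [Fintype k'] (A : Matrix m k ℝ) (B : Matrix k l ℝ) (em : m' ≃ m) (ek : k' ≃ k) (el : l' ≃ l) :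
    liftC (A * B) em el = liftC A em ek * liftC B ek el := by
  ext i j
  simp only [liftC_apply, Matrix.mul_apply, Complex.ofReal_sum, Complex.ofReal_mul]
  exact (Equiv.sum_comp ek (fun x => ((A (em i) x : ℝ) : ℂ) * ((B x (el j) : ℝ) : ℂ))).symm

/-- the transport of `1` is `1`. [cite: Balaban1984PropagatorsI, (1.120) p.37 (operators on T_η as matrices; index transport, dictionary)] -/
theorem liftC_one [DecidableEq m] [DecidableEq m'] (em : m' ≃ m) : liftC (1 : Matrix m m ℝ) em em = 1 := by
  ext i j
  simp only [liftC_apply, Matrix.one_apply, em.apply_eq_iff_eq]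
  split_ifs <;> simp

/-- adjoint of a transported real matrix = transport of the transpose. [cite: Balaban1984PropagatorsI, (1.120) p.37 (operators on T_η as matrices; index transport, dictionary)] -/
theorem liftC_conjTranspose (A : Matrix m k ℝ) (em : m' ≃ m) (ek : k' ≃ k) :
    (liftC A em ek)ᴴ = liftC Aᵀ ek em := by
  ext i j
  simp [liftC_apply, Matrix.conjTranspose_apply, Matrix.transpose_apply, Complex.conj_ofReal]

/-- scalars pass through. [cite: Balaban1984PropagatorsI, (1.120) p.37 (operators on T_η as matrices; index transport, dictionary)] -/
theorem liftC_smul (r : ℝ) (A : Matrix m k ℝ) (em : m' ≃ m) (ek : k' ≃ k) :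
    liftC (r • A) em ek = (r : ℂ) • liftC A em ek := by
  ext i j
  simp [liftC_apply]

/-- additivity. [cite: Balaban1984PropagatorsI, (1.120) p.37 (operators on T_η as matrices; index transport, dictionary)] -/
theorem liftC_sub (A B : Matrix m k ℝ) (em : m' ≃ m) (ek : k' ≃ k) :
    liftC (A - B) em ek = liftC A em ek - liftC B em ek := by
  ext i j
  simp [liftC_apply]

end Lift

/-! ## §2 b05's `KRe` and `KRe·kerRe·QGRe` on the typed tori -/

section Torus

variable {d : ℕ} (n : ℕ) [NeZero n] (M : Fin (d + 1) → ℕ) [hM : ∀ μ, NeZero (M μ)]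

/-- the matrix of `ω ↦ G′Q′*ω` (b05's `KRe`, transported): `T_η ← T₁`. [cite: Balaban1984PropagatorsI, p.38 ll.7–10 (G′Q′*)] -/
def Kfl (a : ℝ) : Matrix (Tor (fine n M)) (Tor M) ℂ :=
  liftC (KRe n a M) (torIdx (fine n M)) (torIdx M)

/-- **b05's matrix of `P = G′Q′*(Q′G′²Q′*)⁻¹Q′G′`, transported to `T_η = Tor (fine n M)`**.
[cite: Balaban1984PropagatorsI, p.38 ll.7–10] -/
def Pfl (a : ℝ) : Matrix (Tor (fine n M)) (Tor (fine n M)) ℂ :=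
  liftC (KRe n a M * kerRe n a M * QGRe n a M) (torIdx (fine n M)) (torIdx (fine n M))

/-- the middle-right factor `(Q′G′²Q′*)⁻¹Q′G′`, transported: `T₁ ← T_η`. [cite: Balaban1984PropagatorsI, p.38 ll.7–10] -/
def Xfl (a : ℝ) : Matrix (Tor M) (Tor (fine n M)) ℂ :=
  liftC (kerRe n a M * QGRe n a M) (torIdx M) (torIdx (fine n M))

omit hM in
/-- `M_i ≥ 1`. [folklore] -/
private theorem hM1 [hM : ∀ μ, NeZero (M μ)] : ∀ i, 1 ≤ M i := fun i => Nat.one_le_iff_ne_zero.mpr (NeZero.ne (M i))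

omit hM in
/-- **`Kfl *ᵥ ω = K_Tω`** (`= G′Q′*ω`): the transported `KRe` acts as r02's `KTvec`. [cite: Balaban1984PropagatorsI, p.38 ll.7–10]
[cite: Balaban1983RegularityDecay, (2.48) p.585] -/
theorem Kfl_mulVec [hM : ∀ μ, NeZero (M μ)] (hn : 1 ≤ n) {a : ℝ} (ha : 0 < a) (ω : Tor M → ℂ) :
    Kfl n M a *ᵥ ω = KTvec n M a ω := by
  funext x
  have hK : KTvec n M a ω x = ∑ y ∈ box M, ω (castU M y) * KT n a 0 M (repZ n M x) y := rfl
  rw [hK, sum_box_eq_sum_idx, ← Equiv.sum_comp (torIdx M)]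
  simp only [Matrix.mulVec, dotProduct, Kfl, liftC_apply]
  refine Finset.sum_congr rfl fun y _ => ?_
  rw [KRe_coe n hn a ha (hM1 M), castU_toZ, Equiv.symm_apply_apply, mul_comm]
  rfl

omit hM in
/-- `(Δ + aQ′*Q′)·Kfl = Q′*` (b04's Green identity, columnwise). [cite: Balaban1984PropagatorsI, p.25 (after (1.42): Δ′_a = Δ + aQ′_k*Q′_k, G′_k its inverse), p.38 ll.7–10] -/
theorem greenOp_mul_Kfl [hM : ∀ μ, NeZero (M μ)] (hn : 1 ≤ n) {a : ℝ} (ha : 0 < a) :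
    (LapS (fine n M) (n : ℂ) + (a : ℂ) • (QsAdj n M * QsOp n M)) * Kfl n M a = QsAdj n M :=
  ext_of_mulVec' fun ω => by rw [← Matrix.mulVec_mulVec, Kfl_mulVec n M hn ha, green_KTvec n M hn ha]

omit hM in
/-- `Kfl = G′Q′*`. [cite: Balaban1984PropagatorsI, p.25 (after (1.42): Δ′_a = Δ + aQ′_k*Q′_k, G′_k its inverse), p.38 ll.7–10] -/
theorem Kfl_eq [hM : ∀ μ, NeZero (M μ)] (hn : 1 ≤ n) {a : ℝ} (ha : 0 < a) :
    Kfl n M a = (LapS (fine n M) (n : ℂ) + (a : ℂ) • (QsAdj n M * QsOp n M))⁻¹ * QsAdj n M := by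
  calc Kfl n M a = (LapS (fine n M) (n : ℂ) + (a : ℂ) • (QsAdj n M * QsOp n M))⁻¹
        * ((LapS (fine n M) (n : ℂ) + (a : ℂ) • (QsAdj n M * QsOp n M)) * Kfl n M a) := by
        rw [← Matrix.mul_assoc, inv_mul_greenOp n M ha, Matrix.one_mul]
    _ = _ := by rw [greenOp_mul_Kfl n M hn ha]

omit hM in
/-- `Kflᴴ = n^{d+1}·Q′G′`. [cite: Balaban1984PropagatorsI, (1.21) p.21, p.38 ll.7–10] -/
theorem Kfl_conjTranspose [hM : ∀ μ, NeZero (M μ)] (hn : 1 ≤ n) {a : ℝ} (ha : 0 < a) :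
    (Kfl n M a)ᴴ = ((n : ℂ) ^ (d + 1)) • (QsOp n M * (LapS (fine n M) (n : ℂ) + (a : ℂ) • (QsAdj n M * QsOp n M))⁻¹) := by
  rw [Kfl_eq n M hn ha, Matrix.conjTranspose_mul, QsAdj_conjTranspose, (greenInv_isHermitian n M a).eq, Matrix.smul_mul]

/-- b05's matrix of `P` times `KRe` is `KRe` (`(Q′G′²Q′*)⁻¹·(Q′G′·G′Q′*) = 1`). [cite: Balaban1984PropagatorsI, p.38 ll.7–10] -/
theorem matP_mul_KRe (hn : 1 ≤ n) {a : ℝ} (ha : 0 < a) :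
    KRe n a M * kerRe n a M * QGRe n a M * KRe n a M = KRe n a M := by
  rw [Matrix.mul_assoc, QGRe_mul_KRe n hn a ha (hM1 M), Matrix.mul_assoc, kerRe_mul_qggqRe n hn a ha (hM1 M), Matrix.mul_one]

/-- b05's matrix of `P` is symmetric (`kerRe` even, `QGRe = η^{d+1}KReᵀ`). [cite: Balaban1984PropagatorsI, p.38 ll.7–10] -/
theorem matP_transpose (hn : 1 ≤ n) {a : ℝ} (ha : 0 < a) :
    (KRe n a M * kerRe n a M * QGRe n a M)ᵀ = KRe n a M * kerRe n a M * QGRe n a M := by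
  rw [QGRe, Matrix.mul_smul, Matrix.transpose_smul, Matrix.transpose_mul, Matrix.transpose_mul, Matrix.transpose_transpose,
    (kerRe_isSymm n hn a ha (hM1 M)).eq, Matrix.mul_assoc]

/-- `Pfl = Kfl·Xfl`. [cite: Balaban1984PropagatorsI, p.38 ll.7–10] -/
theorem Pfl_eq_Kfl_mul_Xfl (a : ℝ) : Pfl n M a = Kfl n M a * Xfl n M a := by
  rw [Pfl, Kfl, Xfl, Matrix.mul_assoc, liftC_mul _ _ (torIdx (fine n M)) (torIdx M) (torIdx (fine n M))]

/-- `Pfl` is Hermitian («orthogonal projection»). [cite: Balaban1984PropagatorsI, p.25, p.38 ll.7–10] -/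
theorem Pfl_conjTranspose (hn : 1 ≤ n) {a : ℝ} (ha : 0 < a) : (Pfl n M a)ᴴ = Pfl n M a := by
  rw [Pfl, liftC_conjTranspose, matP_transpose n M hn ha]

/-- `Pfl·Kfl = Kfl`: `P` fixes the range of `G′Q′*`. [cite: Balaban1984PropagatorsI, p.38 ll.7–10] -/
theorem Pfl_mul_Kfl (hn : 1 ≤ n) {a : ℝ} (ha : 0 < a) : Pfl n M a * Kfl n M a = Kfl n M a := by
  rw [Pfl, Kfl, ← liftC_mul _ _ (torIdx (fine n M)) (torIdx (fine n M)) (torIdx M), matP_mul_KRe n M hn ha]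

omit hM in
/-- `Q′G′·Pfl = Q′G′`. [cite: Balaban1984PropagatorsI, p.38 ll.7–10] -/
theorem QsOp_greenInv_mul_Pfl [hM : ∀ μ, NeZero (M μ)] (hn : 1 ≤ n) {a : ℝ} (ha : 0 < a) :
    QsOp n M * (LapS (fine n M) (n : ℂ) + (a : ℂ) • (QsAdj n M * QsOp n M))⁻¹ * Pfl n M a
      = QsOp n M * (LapS (fine n M) (n : ℂ) + (a : ℂ) • (QsAdj n M * QsOp n M))⁻¹ := by
  have hc : ((n : ℂ) ^ (d + 1)) ≠ 0 := pow_ne_zero _ (Nat.cast_ne_zero.mpr (NeZero.ne n))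
  have h := congrArg Matrix.conjTranspose (Pfl_mul_Kfl n M hn ha)
  rw [Matrix.conjTranspose_mul, Pfl_conjTranspose n M hn ha, Kfl_conjTranspose n M hn ha, Matrix.smul_mul] at h
  exact smul_right_injective _ hc h

omit hM in
/-- `(Δ + aQ′*Q′)·Pfl = Q′*·Xfl`. [cite: Balaban1984PropagatorsI, p.25 (after (1.42): Δ′_a = Δ + aQ′_k*Q′_k, G′_k its inverse), p.38 ll.7–10] -/
theorem greenOp_mul_Pfl [hM : ∀ μ, NeZero (M μ)] (hn : 1 ≤ n) {a : ℝ} (ha : 0 < a) :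
    (LapS (fine n M) (n : ℂ) + (a : ℂ) • (QsAdj n M * QsOp n M)) * Pfl n M a = QsAdj n M * Xfl n M a := by
  rw [Pfl_eq_Kfl_mul_Xfl, ← Matrix.mul_assoc, greenOp_mul_Kfl n M hn ha]

omit hM in
/-- `Pfl·(Δ + aQ′*Q′) = n^{d+1}·Xflᴴ·Q′`. [cite: Balaban1984PropagatorsI, p.25 (after (1.42): Δ′_a = Δ + aQ′_k*Q′_k, G′_k its inverse), p.38 ll.7–10] -/
theorem Pfl_mul_greenOp [hM : ∀ μ, NeZero (M μ)] (hn : 1 ≤ n) {a : ℝ} (ha : 0 < a) :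
    Pfl n M a * (LapS (fine n M) (n : ℂ) + (a : ℂ) • (QsAdj n M * QsOp n M))
      = ((n : ℂ) ^ (d + 1)) • ((Xfl n M a)ᴴ * QsOp n M) := by
  have h := congrArg Matrix.conjTranspose (greenOp_mul_Pfl n M hn ha)
  rwa [Matrix.conjTranspose_mul, Matrix.conjTranspose_mul, Pfl_conjTranspose n M hn ha, (greenOp_isHermitian n M a).eq,
    QsAdj_conjTranspose, Matrix.mul_smul] at h

omit hM in
/-- `Δl = (Δ + aQ′*Q′)l` on `N(Q′)`. [cite: Balaban1984PropagatorsI, p.25 (ΔN(Q′_k))] -/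
theorem LapS_mulVec_of_ker [hM : ∀ μ, NeZero (M μ)] (a : ℝ) (l : Tor (fine n M) → ℂ) (hl : QsOp n M *ᵥ l = 0) :
    LapS (fine n M) (n : ℂ) *ᵥ l = (LapS (fine n M) (n : ℂ) + (a : ℂ) • (QsAdj n M * QsOp n M)) *ᵥ l := by
  rw [Matrix.add_mulVec, Matrix.smul_mulVec, ← Matrix.mulVec_mulVec, hl, Matrix.mulVec_zero, smul_zero, add_zero]

omit hM in
/-- p. 25 «RΔλ = Δλ if Q′_kλ = 0» for `R := 1 − Pfl`: `Pfl·(Δl) = 0` when `Q′l = 0`. [cite: Balaban1984PropagatorsI, p.25] -/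
theorem Pfl_mulVec_LapS_of_ker [hM : ∀ μ, NeZero (M μ)] (hn : 1 ≤ n) {a : ℝ} (ha : 0 < a) (l : Tor (fine n M) → ℂ)
    (hl : QsOp n M *ᵥ l = 0) : Pfl n M a *ᵥ (LapS (fine n M) (n : ℂ) *ᵥ l) = 0 := by
  rw [LapS_mulVec_of_ker n M a l hl, Matrix.mulVec_mulVec, Pfl_mul_greenOp n M hn ha, Matrix.smul_mulVec,
    ← Matrix.mulVec_mulVec, hl, Matrix.mulVec_zero, smul_zero]

omit hM in
/-- p. 25 «if Rω = ω then … ω = Δλ and Q′_kλ = 0» for `R := 1 − Pfl`, strong form: EVERY `(1 − Pfl)w` is a `Δλ` with `Q′λ = 0`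
(`λ = G′(1 − Pfl)w`). [cite: Balaban1984PropagatorsI, p.25 (R; and after (1.42): G′_k)] -/
theorem one_sub_Pfl_mulVec_eq_LapS [hM : ∀ μ, NeZero (M μ)] (hn : 1 ≤ n) {a : ℝ} (ha : 0 < a) (w : Tor (fine n M) → ℂ) :
    ∃ l : Tor (fine n M) → ℂ, QsOp n M *ᵥ l = 0 ∧ (1 - Pfl n M a) *ᵥ w = LapS (fine n M) (n : ℂ) *ᵥ l := by
  have hl : QsOp n M *ᵥ ((LapS (fine n M) (n : ℂ) + (a : ℂ) • (QsAdj n M * QsOp n M))⁻¹ *ᵥ ((1 - Pfl n M a) *ᵥ w)) = 0 := by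
    simp only [Matrix.mulVec_mulVec, Matrix.mul_sub, Matrix.mul_one, ← Matrix.mul_assoc]
    rw [QsOp_greenInv_mul_Pfl n M hn ha, sub_self, Matrix.zero_mulVec]
  refine ⟨_, hl, ?_⟩
  rw [LapS_mulVec_of_ker n M a _ hl, Matrix.mulVec_mulVec ((1 - Pfl n M a) *ᵥ w), greenOp_mul_inv n M ha, Matrix.one_mulVec]

omit hM in
/-- **`1 − Pfl = RT`**: b05's matrix of `P`, transported, is `I − R` with `R` THE orthogonal projection onto `ΔN(Q′_k)` — both
`1 − Pfl` and `RT` are Hermitian with fixed space `ΔN(Q′_k)` (p. 25), which pins them down. [cite: Balaban1984PropagatorsI, p.25,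
(1.69)–(1.70) pp.29–30, p.38 ll.7–10] -/
theorem one_sub_Pfl_eq_RT [hM : ∀ μ, NeZero (M μ)] (hn : 1 ≤ n) {a : ℝ} (ha : 0 < a) : 1 - Pfl n M a = RT n M := by
  have h1 : RT n M * (1 - Pfl n M a) = 1 - Pfl n M a := ext_of_mulVec' fun w => by
    obtain ⟨l, hl, hw⟩ := one_sub_Pfl_mulVec_eq_LapS n M hn ha w
    rw [← Matrix.mulVec_mulVec, hw, RT_mulVec_LapS_of_ker n M l hl]
  have h2 : (1 - Pfl n M a) * RT n M = RT n M := ext_of_mulVec' fun w => by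
    obtain ⟨l, hl, hw⟩ := RT_mulVec_eq_LapS n M w
    rw [← Matrix.mulVec_mulVec, hw, Matrix.sub_mulVec, Matrix.one_mulVec, Pfl_mulVec_LapS_of_ker n M hn ha l hl, sub_zero]
  have hH : (1 - Pfl n M a)ᴴ = 1 - Pfl n M a := by
    rw [Matrix.conjTranspose_sub, Matrix.conjTranspose_one, Pfl_conjTranspose n M hn ha]
  have h3 : (1 - Pfl n M a) * RT n M = 1 - Pfl n M a := by
    have h := congrArg Matrix.conjTranspose h1
    rwa [Matrix.conjTranspose_mul, RT_conjTranspose, hH] at h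
  rw [← h3, h2]

omit hM in
/-- **`Pfl = PcT + Pker`**: p. 38's `P = G′Q′*(Q′G′²Q′*)⁻¹Q′G′` equals (1.70)'s `Δ⁻¹Q′*(Q′Δ⁻²Q′*)⁻¹Q′Δ⁻¹` plus the projection onto
the constants (on which (1.70), typed with the pseudo-inverse `Δ⁻¹`, vanishes while `P1 = 1`). [cite: Balaban1984PropagatorsI,
(1.70) p.30, p.38 ll.7–10] -/
theorem Pfl_eq_PcT_add_Pker [hM : ∀ μ, NeZero (M μ)] (hn : 1 ≤ n) {a : ℝ} (ha : 0 < a) :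
    Pfl n M a = PcT n M (n : ℂ) + Pker (fine n M) (n : ℂ) := by
  have h := one_sub_Pfl_eq_RT n M hn ha
  rw [RT, sub_sub, sub_right_inj] at h
  exact h

omit hM in
/-- `Pfl` is idempotent. [cite: Balaban1984PropagatorsI, p.25, p.38 ll.7–10] -/
theorem Pfl_mul_Pfl [hM : ∀ μ, NeZero (M μ)] (hn : 1 ≤ n) {a : ℝ} (ha : 0 < a) : Pfl n M a * Pfl n M a = Pfl n M a := by
  nth_rw 2 [Pfl_eq_Kfl_mul_Xfl n M a]
  rw [← Matrix.mul_assoc, Pfl_mul_Kfl n M hn ha, ← Pfl_eq_Kfl_mul_Xfl]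

omit hM in
/-- `Pfl` does not depend on `a > 0`. [cite: Balaban1984PropagatorsI, p.25 «with a > 0 (we will take eventually a = 1)»] -/
theorem Pfl_indep [hM : ∀ μ, NeZero (M μ)] (hn : 1 ≤ n) {a b : ℝ} (ha : 0 < a) (hb : 0 < b) : Pfl n M a = Pfl n M b := by
  rw [Pfl_eq_PcT_add_Pker n M hn ha, Pfl_eq_PcT_add_Pker n M hn hb]

omit hM in
/-- **`∂·PcT·∂ᴴ = ∂·Pfl·∂ᴴ`**: r02's `∂P∂*` block of `DeltaA` (typed with (1.70)'s `PcT`) IS b05's matrix of `∂P∂*` with p. 38's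
`P`, transported (`∂` kills the constants). [cite: Balaban1984PropagatorsI, (1.69)–(1.70) pp.29–30, p.38 ll.7–10] -/
theorem GradOp_PcT_GradOp_adjoint_eq [hM : ∀ μ, NeZero (M μ)] (hn : 1 ≤ n) {a : ℝ} (ha : 0 < a) :
    GradOp (fine n M) (n : ℂ) * PcT n M (n : ℂ) * (GradOp (fine n M) (n : ℂ))ᴴ
      = GradOp (fine n M) (n : ℂ) * Pfl n M a * (GradOp (fine n M) (n : ℂ))ᴴ := by
  rw [Pfl_eq_PcT_add_Pker n M hn ha, Matrix.mul_add, Matrix.add_mul, Matrix.mul_assoc _ (Pker _ _), Pker_mul_GradOp_adjoint,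
    Matrix.mul_zero, add_zero]

/-! ## §3 The printed representations, literally, in r02's typed vocabulary: p. 38 «P = G′Q′*(Q′G′²Q′*)⁻¹Q′G′» and (1.44) -/

omit hM in
/-- the transport commutes with inverses (square case). [cite: Balaban1984PropagatorsI, (1.120) p.37 (operators on T_η as matrices;
index transport, dictionary)] -/
theorem liftC_inv_of_mul_eq_one {m m' : Type*} [Fintype m] [Fintype m'] [DecidableEq m] [DecidableEq m']
    (A B : Matrix m m ℝ) (h : B * A = 1) (em : m' ≃ m) : liftC B em em = (liftC A em em)⁻¹ :=
  Matrix.inv_eq_left_inv (by rw [← liftC_mul _ _ em em em, h, liftC_one]) |>.symm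

omit hM in
/-- **b05's `QGRe` (the matrix of `Q′G′`), transported, is `Q′·G′`** in r02's typing. [cite: Balaban1984PropagatorsI, p.38 ll.7–10 (Q′G′),
(1.21) p.21] -/
theorem liftC_QGRe [hM : ∀ μ, NeZero (M μ)] (hn : 1 ≤ n) {a : ℝ} (ha : 0 < a) :
    liftC (QGRe n a M) (torIdx M) (torIdx (fine n M))
      = QsOp n M * (LapS (fine n M) (n : ℂ) + (a : ℂ) • (QsAdj n M * QsOp n M))⁻¹ := by
  have hc : ((n : ℂ) ^ (d + 1)) ≠ 0 := pow_ne_zero _ (Nat.cast_ne_zero.mpr (NeZero.ne n))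
  have h1 : liftC (QGRe n a M) (torIdx M) (torIdx (fine n M)) = ((((n : ℝ) ^ (d + 1))⁻¹ : ℝ) : ℂ) • (Kfl n M a)ᴴ := by
    rw [QGRe, liftC_smul, Kfl, liftC_conjTranspose]
  rw [h1, Kfl_conjTranspose n M hn ha, smul_smul]
  have h2 : ((((n : ℝ) ^ (d + 1))⁻¹ : ℝ) : ℂ) * (n : ℂ) ^ (d + 1) = 1 := by
    push_cast
    exact inv_mul_cancel₀ hc
  rw [h2, one_smul]

omit hM in
/-- **b05's `qggqRe` (the matrix of `Q′G′²Q′*`), transported, is `Q′·G′·G′·Q′*`**. [cite: Balaban1984PropagatorsI, p.25 («Q′_kG′_k²Q′_k* is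
positive definite»), p.38 ll.7–10] -/
theorem liftC_qggqRe [hM : ∀ μ, NeZero (M μ)] (hn : 1 ≤ n) {a : ℝ} (ha : 0 < a) :
    liftC (qggqRe n a M) (torIdx M) (torIdx M)
      = QsOp n M * (LapS (fine n M) (n : ℂ) + (a : ℂ) • (QsAdj n M * QsOp n M))⁻¹
          * (LapS (fine n M) (n : ℂ) + (a : ℂ) • (QsAdj n M * QsOp n M))⁻¹ * QsAdj n M := by
  rw [← QGRe_mul_KRe n hn a ha (hM1 M), liftC_mul _ _ (torIdx M) (torIdx (fine n M)) (torIdx M), liftC_QGRe n M hn ha, ← Kfl,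
    Kfl_eq n M hn ha, Matrix.mul_assoc, Matrix.mul_assoc, Matrix.mul_assoc]

omit hM in
/-- **`Q′G′²Q′*` IS INVERTIBLE** on the unit torus, its inverse being b05's kernel `kerRe` transported («It is enough to prove that
Q′_kG′_k²Q′_k* is positive definite … hence ω = 0» p. 25). [cite: Balaban1984PropagatorsI, p.25] -/
theorem liftC_kerRe [hM : ∀ μ, NeZero (M μ)] (hn : 1 ≤ n) {a : ℝ} (ha : 0 < a) :
    liftC (kerRe n a M) (torIdx M) (torIdx M)
      = (QsOp n M * (LapS (fine n M) (n : ℂ) + (a : ℂ) • (QsAdj n M * QsOp n M))⁻¹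
          * (LapS (fine n M) (n : ℂ) + (a : ℂ) • (QsAdj n M * QsOp n M))⁻¹ * QsAdj n M)⁻¹ := by
  rw [← liftC_qggqRe n M hn ha]
  exact liftC_inv_of_mul_eq_one _ _ (kerRe_mul_qggqRe n hn a ha (hM1 M)) (torIdx M)

omit hM in
/-- `(Q′G′²Q′*)⁻¹·(Q′G′²Q′*) = 1` in r02's typing. [cite: Balaban1984PropagatorsI, p.25] -/
theorem QGGQs_inv_mul [hM : ∀ μ, NeZero (M μ)] (hn : 1 ≤ n) {a : ℝ} (ha : 0 < a) :
    (QsOp n M * (LapS (fine n M) (n : ℂ) + (a : ℂ) • (QsAdj n M * QsOp n M))⁻¹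
          * (LapS (fine n M) (n : ℂ) + (a : ℂ) • (QsAdj n M * QsOp n M))⁻¹ * QsAdj n M)⁻¹
      * (QsOp n M * (LapS (fine n M) (n : ℂ) + (a : ℂ) • (QsAdj n M * QsOp n M))⁻¹
          * (LapS (fine n M) (n : ℂ) + (a : ℂ) • (QsAdj n M * QsOp n M))⁻¹ * QsAdj n M) = 1 := by
  rw [← liftC_kerRe n M hn ha, ← liftC_qggqRe n M hn ha, ← liftC_mul _ _ (torIdx M) (torIdx M) (torIdx M),
    kerRe_mul_qggqRe n hn a ha (hM1 M), liftC_one]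

omit hM in
/-- `(Q′G′²Q′*)·(Q′G′²Q′*)⁻¹ = 1` in r02's typing. [cite: Balaban1984PropagatorsI, p.25] -/
theorem QGGQs_mul_inv [hM : ∀ μ, NeZero (M μ)] (hn : 1 ≤ n) {a : ℝ} (ha : 0 < a) :
    (QsOp n M * (LapS (fine n M) (n : ℂ) + (a : ℂ) • (QsAdj n M * QsOp n M))⁻¹
          * (LapS (fine n M) (n : ℂ) + (a : ℂ) • (QsAdj n M * QsOp n M))⁻¹ * QsAdj n M)
      * (QsOp n M * (LapS (fine n M) (n : ℂ) + (a : ℂ) • (QsAdj n M * QsOp n M))⁻¹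
          * (LapS (fine n M) (n : ℂ) + (a : ℂ) • (QsAdj n M * QsOp n M))⁻¹ * QsAdj n M)⁻¹ = 1 := by
  rw [← liftC_kerRe n M hn ha, ← liftC_qggqRe n M hn ha, ← liftC_mul _ _ (torIdx M) (torIdx M) (torIdx M),
    qggqRe_mul_kerRe n hn a ha (hM1 M), liftC_one]

omit hM in
/-- **p. 38 ll. 7–10, LITERALLY, for r02's typed torus operators: `Pfl = G′·Q′*·(Q′G′²Q′*)⁻¹·Q′·G′`** (`G′ = (Δ + aQ′*Q′)⁻¹`, `Q′* = QsAdj`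
the weighted adjoint). [cite: Balaban1984PropagatorsI, p.38 ll.7–10 «the representation P = G′Q′*(Q′G′²Q′*)⁻¹Q′G′»] -/
theorem Pfl_eq_green [hM : ∀ μ, NeZero (M μ)] (hn : 1 ≤ n) {a : ℝ} (ha : 0 < a) :
    Pfl n M a = (LapS (fine n M) (n : ℂ) + (a : ℂ) • (QsAdj n M * QsOp n M))⁻¹ * QsAdj n M
      * (QsOp n M * (LapS (fine n M) (n : ℂ) + (a : ℂ) • (QsAdj n M * QsOp n M))⁻¹
          * (LapS (fine n M) (n : ℂ) + (a : ℂ) • (QsAdj n M * QsOp n M))⁻¹ * QsAdj n M)⁻¹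
      * (QsOp n M * (LapS (fine n M) (n : ℂ) + (a : ℂ) • (QsAdj n M * QsOp n M))⁻¹) := by
  rw [Pfl_eq_Kfl_mul_Xfl, Xfl, liftC_mul _ _ (torIdx M) (torIdx M) (torIdx (fine n M)), liftC_kerRe n M hn ha,
    liftC_QGRe n M hn ha, Kfl_eq n M hn ha]
  simp only [Matrix.mul_assoc]

omit hM in
/-- **(1.44) / (1.69) «R = I − P», LITERALLY, for r02's `RT`: `RT = 1 − G′Q′*(Q′G′²Q′*)⁻¹Q′G′`** — the matrix of record for `R`
(`B5Identities197Torus.RT`, the orthogonal projection onto `ΔN(Q′_k)`) in the `G′`-representation, every `a > 0`.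
[cite: Balaban1984PropagatorsI, (1.44) p.25, (1.69) p.29 «R = I − P», p.38 ll.7–10] -/
theorem RT_eq_one_sub_green [hM : ∀ μ, NeZero (M μ)] (hn : 1 ≤ n) {a : ℝ} (ha : 0 < a) :
    RT n M = 1 - (LapS (fine n M) (n : ℂ) + (a : ℂ) • (QsAdj n M * QsOp n M))⁻¹ * QsAdj n M
      * (QsOp n M * (LapS (fine n M) (n : ℂ) + (a : ℂ) • (QsAdj n M * QsOp n M))⁻¹
          * (LapS (fine n M) (n : ℂ) + (a : ℂ) • (QsAdj n M * QsOp n M))⁻¹ * QsAdj n M)⁻¹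
      * (QsOp n M * (LapS (fine n M) (n : ℂ) + (a : ℂ) • (QsAdj n M * QsOp n M))⁻¹) := by
  rw [← Pfl_eq_green n M hn ha, one_sub_Pfl_eq_RT n M hn ha]

omit hM in
/-- **(1.70) meets p. 38: `PcT + Pker = G′Q′*(Q′G′²Q′*)⁻¹Q′G′`** — the `Δ⁻¹`-representation (plus the constant mode) equals the
`G′`-representation. [cite: Balaban1984PropagatorsI, (1.70) p.30, p.38 ll.7–10] -/
theorem PcT_add_Pker_eq_green [hM : ∀ μ, NeZero (M μ)] (hn : 1 ≤ n) {a : ℝ} (ha : 0 < a) :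
    PcT n M (n : ℂ) + Pker (fine n M) (n : ℂ)
      = (LapS (fine n M) (n : ℂ) + (a : ℂ) • (QsAdj n M * QsOp n M))⁻¹ * QsAdj n M
      * (QsOp n M * (LapS (fine n M) (n : ℂ) + (a : ℂ) • (QsAdj n M * QsOp n M))⁻¹
          * (LapS (fine n M) (n : ℂ) + (a : ℂ) • (QsAdj n M * QsOp n M))⁻¹ * QsAdj n M)⁻¹
      * (QsOp n M * (LapS (fine n M) (n : ℂ) + (a : ℂ) • (QsAdj n M * QsOp n M))⁻¹) := by
  rw [← Pfl_eq_PcT_add_Pker n M hn ha, Pfl_eq_green n M hn ha]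

end Torus

end

end Literature.MathematicalPhysics.QuantumFieldTheory.Balaban1983to89.B5PBridgeProjection
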